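import Summits.Ventures.CertifiedManyBodySolver.Observables.RungLeavesCoverage
import Summits.Ventures.CertifiedManyBodySolver.Observables.StiffnessApexTransportCurtainLadderLaBoxE
import HarnessLib

/-!
# M2(b) closers from THREE STATIONS `29/5, 8, 11` with SHORT corner-objective overhangs (`boxLa214E_M2b`, «La214-E» `[−3/10, −1/5] × [29/5, 74/5] × n = 1`)

Venture CertifiedManyBodySolver, cell `pub/hubbard-downfold` (MO-S1 ↔ S2 seam; D-0154 (1)(C) COVERAGE, La214 M2(b) depth); namespace
`Summit.Ventures.CertifiedManyBodySolver.Downfold`; seat `hubbard-cov-la214-unc-2` (`prover-hubbard-cov-la214-unc-2-0`). Companion of `Downfold/BoxesLa214V115M2b.lean` §2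
(`boxLa214E_M2b_stiffnessWord_of_three_apexStations`, seat hubbard-downfold-unc-2 g13/g14: three stations read with OWN words down to the overhang ends) and of
`Observables/StiffnessApexTransportCurtainLadderLaBoxE.lean` (this seat: the corner-objective three-station edition and its six-chord form).

THE THREE-STATION FALLBACK OF RECORD (director-hubbard R19; obs RULING (ggg) d303 (ggg2) case (2): «if the −357/740 corner word threatens the bar, fall back to THREE
stations 29/5, 8, 11 with overhang only to ≈ −0.383»; parents pre-registered by `hubbard-cov-la214-gen-1` W1a–e, solves claimed by `hubbard-cov-la214-sdp-1`): station
`U_k ∈ {29/5, 8, 11}` carries an INNER bundle on `[−3/10, −1/5] × {U_k}` (own words) and an OVERHANG bundle on `[−153/400 | −21/55 | −279/740, −3/10] × {U_k}` read with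
the CORNER objective `−X₀(−3/10)` (kinematic scale `k(−3/10) = 0.4392` at every overhang source [float]). ONE-`exact` CLOSERS of the M2(b) stiffness word
`HoldsOn (p ↦ ObsStiffnessSeqCeilingAt (p tp) (p U) (p n) c) boxLa214E_M2b` and of the rung leaf `La214M2b_StiffnessBoxCeiling` (bar `0.4364687`):
* `boxLa214E_M2b_stiffnessWord_of_threeStations_inner_and_cornerObjectiveOverhang` — family form (six families);
* `boxLa214E_M2b_stiffnessWord_of_threeStations_sixChords` / `La214M2b_StiffnessBoxCeiling_of_threeStations_sixBundles` — SIX BUNDLES, twelve vertex constants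
  (nine distinct certificates: at each station the `(U_k; −3/10)` own word serves both chords), `c ≥` each negated constant (`≤ 0.4364687` for the leaf).

Everything here is PROVED; no `sorry`, no definition. HONEST FRAMING: one-sided stiffness CEILINGS conditional BY NAME on bundles no producer has delivered yet
(CONTROL/CALIBRATION class at Mott points; a ceiling is silent on `ρ_s = 0`); typing certifies nothing about La₂CuO₄; no summit statement is proved here; no phase
sentence; no number of record.
-/

noncomputable section

namespace Summit.Ventures.CertifiedManyBodySolver.Downfold

open Set NonemptyInterval
open Summit.Ventures.CertifiedManyBodySolver.Observables
open Summit.Ventures.CertifiedManyBodySolver.Certificates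
open Literature.MathematicalPhysics.QuantumLattice Literature.MathematicalPhysics.QuantumLattice.ThermodynamicLimit
open Literature.Probability.LatticeModels
open Matrix Finset HubbardWave0
open scoped BigOperators ComplexOrder

/-- **M2(b) CLOSER — THREE STATIONS `29/5, 8, 11`, corner-objective overhangs, family form.** For each station an own-word orbit-lower family `valIₖ` on
`[−3/10, −1/5] × {U_k}` and a corner-objective (`−X₀(−3/10)`) family `valOₖ` on the short overhang `[−153/400 | −21/55 | −279/740, −3/10] × {U_k}` (half filling),
all with `−val ≤ c` ⇒ the stiffness word `c` on `boxLa214E_M2b`. [cite: KomaTasaki1994, §1] [cite: ScalapinoWhiteZhang1993, §II] -/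
theorem boxLa214E_M2b_stiffnessWord_of_threeStations_inner_and_cornerObjectiveOverhang (valI₁ valO₁ valI₂ valO₂ valI₃ valO₃ : ℝ → ℝ) (c : ℚ)
    (hI₁ : ∀ s ∈ Set.Icc (-3 / 10 : ℝ) (-1 / 5),
      ∀ (ω : InfVolFermionState 2) (Ls : ℕ → ℕ) (ψ : ∀ L, Fock (Orb (FermionTorus 2 L))),
      Filter.Tendsto Ls Filter.atTop Filter.atTop →
      (∀ j, IsGroundStateInSector (hubbardTorusTT' (Ls j) 1 s (29 / 5)) (rectN 1 (Ls j)) 0 (ψ (Ls j))) →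
      (∀ j, star (ψ (Ls j)) ⬝ᵥ ψ (Ls j) = 1) → ω.IsTorusLimitOf ψ Ls →
      valI₁ s ≤
        ((Finset.univ : Finset (DihedralGroup 4)).card : ℝ)⁻¹ * ∑ g ∈ (Finset.univ : Finset (DihedralGroup 4)),
          (ω.expect (d4ShiftSet g 0 (Literature.Probability.LatticeModels.box 2 7))
            (fermionEmbed (PolySite.d4Emb g 0 (Literature.Probability.LatticeModels.box 2 7)) (-oddMomentObsTT s (29 / 5) 0))).re)
    (hcI₁ : ∀ s ∈ Set.Icc (-3 / 10 : ℝ) (-1 / 5), -valI₁ s ≤ ((c : ℚ) : ℝ))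
    (hO₁ : ∀ s ∈ Set.Icc (-(153 / 400) : ℝ) (-3 / 10),
      ∀ (ω : InfVolFermionState 2) (Ls : ℕ → ℕ) (ψ : ∀ L, Fock (Orb (FermionTorus 2 L))),
      Filter.Tendsto Ls Filter.atTop Filter.atTop →
      (∀ j, IsGroundStateInSector (hubbardTorusTT' (Ls j) 1 s (29 / 5)) (rectN 1 (Ls j)) 0 (ψ (Ls j))) →
      (∀ j, star (ψ (Ls j)) ⬝ᵥ ψ (Ls j) = 1) → ω.IsTorusLimitOf ψ Ls →
      valO₁ s ≤
        ((Finset.univ : Finset (DihedralGroup 4)).card : ℝ)⁻¹ * ∑ g ∈ (Finset.univ : Finset (DihedralGroup 4)),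
          (ω.expect (d4ShiftSet g 0 (Literature.Probability.LatticeModels.box 2 7))
            (fermionEmbed (PolySite.d4Emb g 0 (Literature.Probability.LatticeModels.box 2 7)) (-oddMomentObsTT (-3 / 10) (29 / 5) 0))).re)
    (hcO₁ : ∀ s ∈ Set.Icc (-(153 / 400) : ℝ) (-3 / 10), -valO₁ s ≤ ((c : ℚ) : ℝ))
    (hI₂ : ∀ s ∈ Set.Icc (-3 / 10 : ℝ) (-1 / 5),
      ∀ (ω : InfVolFermionState 2) (Ls : ℕ → ℕ) (ψ : ∀ L, Fock (Orb (FermionTorus 2 L))),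
      Filter.Tendsto Ls Filter.atTop Filter.atTop →
      (∀ j, IsGroundStateInSector (hubbardTorusTT' (Ls j) 1 s 8) (rectN 1 (Ls j)) 0 (ψ (Ls j))) →
      (∀ j, star (ψ (Ls j)) ⬝ᵥ ψ (Ls j) = 1) → ω.IsTorusLimitOf ψ Ls →
      valI₂ s ≤
        ((Finset.univ : Finset (DihedralGroup 4)).card : ℝ)⁻¹ * ∑ g ∈ (Finset.univ : Finset (DihedralGroup 4)),
          (ω.expect (d4ShiftSet g 0 (Literature.Probability.LatticeModels.box 2 7))
            (fermionEmbed (PolySite.d4Emb g 0 (Literature.Probability.LatticeModels.box 2 7)) (-oddMomentObsTT s 8 0))).re)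
    (hcI₂ : ∀ s ∈ Set.Icc (-3 / 10 : ℝ) (-1 / 5), -valI₂ s ≤ ((c : ℚ) : ℝ))
    (hO₂ : ∀ s ∈ Set.Icc (-(21 / 55) : ℝ) (-3 / 10),
      ∀ (ω : InfVolFermionState 2) (Ls : ℕ → ℕ) (ψ : ∀ L, Fock (Orb (FermionTorus 2 L))),
      Filter.Tendsto Ls Filter.atTop Filter.atTop →
      (∀ j, IsGroundStateInSector (hubbardTorusTT' (Ls j) 1 s 8) (rectN 1 (Ls j)) 0 (ψ (Ls j))) →
      (∀ j, star (ψ (Ls j)) ⬝ᵥ ψ (Ls j) = 1) → ω.IsTorusLimitOf ψ Ls →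
      valO₂ s ≤
        ((Finset.univ : Finset (DihedralGroup 4)).card : ℝ)⁻¹ * ∑ g ∈ (Finset.univ : Finset (DihedralGroup 4)),
          (ω.expect (d4ShiftSet g 0 (Literature.Probability.LatticeModels.box 2 7))
            (fermionEmbed (PolySite.d4Emb g 0 (Literature.Probability.LatticeModels.box 2 7)) (-oddMomentObsTT (-3 / 10) 8 0))).re)
    (hcO₂ : ∀ s ∈ Set.Icc (-(21 / 55) : ℝ) (-3 / 10), -valO₂ s ≤ ((c : ℚ) : ℝ))
    (hI₃ : ∀ s ∈ Set.Icc (-3 / 10 : ℝ) (-1 / 5),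
      ∀ (ω : InfVolFermionState 2) (Ls : ℕ → ℕ) (ψ : ∀ L, Fock (Orb (FermionTorus 2 L))),
      Filter.Tendsto Ls Filter.atTop Filter.atTop →
      (∀ j, IsGroundStateInSector (hubbardTorusTT' (Ls j) 1 s 11) (rectN 1 (Ls j)) 0 (ψ (Ls j))) →
      (∀ j, star (ψ (Ls j)) ⬝ᵥ ψ (Ls j) = 1) → ω.IsTorusLimitOf ψ Ls →
      valI₃ s ≤
        ((Finset.univ : Finset (DihedralGroup 4)).card : ℝ)⁻¹ * ∑ g ∈ (Finset.univ : Finset (DihedralGroup 4)),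
          (ω.expect (d4ShiftSet g 0 (Literature.Probability.LatticeModels.box 2 7))
            (fermionEmbed (PolySite.d4Emb g 0 (Literature.Probability.LatticeModels.box 2 7)) (-oddMomentObsTT s 11 0))).re)
    (hcI₃ : ∀ s ∈ Set.Icc (-3 / 10 : ℝ) (-1 / 5), -valI₃ s ≤ ((c : ℚ) : ℝ))
    (hO₃ : ∀ s ∈ Set.Icc (-(279 / 740) : ℝ) (-3 / 10),
      ∀ (ω : InfVolFermionState 2) (Ls : ℕ → ℕ) (ψ : ∀ L, Fock (Orb (FermionTorus 2 L))),
      Filter.Tendsto Ls Filter.atTop Filter.atTop →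
      (∀ j, IsGroundStateInSector (hubbardTorusTT' (Ls j) 1 s 11) (rectN 1 (Ls j)) 0 (ψ (Ls j))) →
      (∀ j, star (ψ (Ls j)) ⬝ᵥ ψ (Ls j) = 1) → ω.IsTorusLimitOf ψ Ls →
      valO₃ s ≤
        ((Finset.univ : Finset (DihedralGroup 4)).card : ℝ)⁻¹ * ∑ g ∈ (Finset.univ : Finset (DihedralGroup 4)),
          (ω.expect (d4ShiftSet g 0 (Literature.Probability.LatticeModels.box 2 7))
            (fermionEmbed (PolySite.d4Emb g 0 (Literature.Probability.LatticeModels.box 2 7)) (-oddMomentObsTT (-3 / 10) 11 0))).re)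
    (hcO₃ : ∀ s ∈ Set.Icc (-(279 / 740) : ℝ) (-3 / 10), -valO₃ s ≤ ((c : ℚ) : ℝ)) :
    HoldsOn (fun p : OneBandCoord → ℝ => ObsStiffnessSeqCeilingAt (p .tpOverT) (p .UOverT) (p .filling) c) boxLa214E_M2b :=
  boxLa214E_M2b_stiffnessWord_of_laBoxE_leaf
    (ObsStiffnessSeqCeilingAt_on_laBoxE_of_threeStations_inner_and_cornerObjectiveOverhang valI₁ valO₁ valI₂ valO₂ valI₃ valO₃ c hI₁ hcI₁ hO₁ hcO₁ hI₂ hcI₂ hO₂ hcO₂ hI₃ hcI₃ hO₃ hcO₃)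

/-- **M2(b) CLOSER — THREE STATIONS, SIX BOXDUAL BUNDLES, twelve vertex constants.** At each station `U_k ∈ {29/5, 8, 11}`: INNER chord `vIₖa` (at `−3/10`) /
`vIₖb` (at `−1/5`) of own words; OVERHANG chord `vOₖa` (at `−153/400 | −21/55 | −279/740`) / `vOₖb` (at `−3/10`) for the CONSTANT objective `−X₀(−3/10)`; `c ≥` each
of the twelve negated constants ⇒ the stiffness word `c` on `boxLa214E_M2b`. [cite: KomaTasaki1994, §1] [cite: ScalapinoWhiteZhang1993, §II] -/
theorem boxLa214E_M2b_stiffnessWord_of_threeStations_sixChords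
    (vI₁a vI₁b vO₁a vO₁b vI₂a vI₂b vO₂a vO₂b vI₃a vI₃b vO₃a vO₃b : ℝ) (c : ℚ)
    (hcI₁a : -vI₁a ≤ ((c : ℚ) : ℝ)) (hcI₁b : -vI₁b ≤ ((c : ℚ) : ℝ)) (hcO₁a : -vO₁a ≤ ((c : ℚ) : ℝ)) (hcO₁b : -vO₁b ≤ ((c : ℚ) : ℝ))
    (hcI₂a : -vI₂a ≤ ((c : ℚ) : ℝ)) (hcI₂b : -vI₂b ≤ ((c : ℚ) : ℝ)) (hcO₂a : -vO₂a ≤ ((c : ℚ) : ℝ)) (hcO₂b : -vO₂b ≤ ((c : ℚ) : ℝ))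
    (hcI₃a : -vI₃a ≤ ((c : ℚ) : ℝ)) (hcI₃b : -vI₃b ≤ ((c : ℚ) : ℝ)) (hcO₃a : -vO₃a ≤ ((c : ℚ) : ℝ)) (hcO₃b : -vO₃b ≤ ((c : ℚ) : ℝ))
    (hI₁ : ∀ s ∈ Set.Icc (-3 / 10 : ℝ) (-1 / 5),
      ∀ (ω : InfVolFermionState 2) (Ls : ℕ → ℕ) (ψ : ∀ L, Fock (Orb (FermionTorus 2 L))),
      Filter.Tendsto Ls Filter.atTop Filter.atTop →
      (∀ j, IsGroundStateInSector (hubbardTorusTT' (Ls j) 1 s (29 / 5)) (rectN 1 (Ls j)) 0 (ψ (Ls j))) →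
      (∀ j, star (ψ (Ls j)) ⬝ᵥ ψ (Ls j) = 1) → ω.IsTorusLimitOf ψ Ls →
      (-1 / 5 - s) / (-1 / 5 - -3 / 10) * vI₁a + (s - -3 / 10) / (-1 / 5 - -3 / 10) * vI₁b ≤
        ((Finset.univ : Finset (DihedralGroup 4)).card : ℝ)⁻¹ * ∑ g ∈ (Finset.univ : Finset (DihedralGroup 4)),
          (ω.expect (d4ShiftSet g 0 (Literature.Probability.LatticeModels.box 2 7))
            (fermionEmbed (PolySite.d4Emb g 0 (Literature.Probability.LatticeModels.box 2 7)) (-oddMomentObsTT s (29 / 5) 0))).re)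
    (hO₁ : ∀ s ∈ Set.Icc (-(153 / 400) : ℝ) (-3 / 10),
      ∀ (ω : InfVolFermionState 2) (Ls : ℕ → ℕ) (ψ : ∀ L, Fock (Orb (FermionTorus 2 L))),
      Filter.Tendsto Ls Filter.atTop Filter.atTop →
      (∀ j, IsGroundStateInSector (hubbardTorusTT' (Ls j) 1 s (29 / 5)) (rectN 1 (Ls j)) 0 (ψ (Ls j))) →
      (∀ j, star (ψ (Ls j)) ⬝ᵥ ψ (Ls j) = 1) → ω.IsTorusLimitOf ψ Ls →
      (-3 / 10 - s) / (-3 / 10 - -(153 / 400)) * vO₁a + (s - -(153 / 400)) / (-3 / 10 - -(153 / 400)) * vO₁b ≤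
        ((Finset.univ : Finset (DihedralGroup 4)).card : ℝ)⁻¹ * ∑ g ∈ (Finset.univ : Finset (DihedralGroup 4)),
          (ω.expect (d4ShiftSet g 0 (Literature.Probability.LatticeModels.box 2 7))
            (fermionEmbed (PolySite.d4Emb g 0 (Literature.Probability.LatticeModels.box 2 7)) (-oddMomentObsTT (-3 / 10) (29 / 5) 0))).re)
    (hI₂ : ∀ s ∈ Set.Icc (-3 / 10 : ℝ) (-1 / 5),
      ∀ (ω : InfVolFermionState 2) (Ls : ℕ → ℕ) (ψ : ∀ L, Fock (Orb (FermionTorus 2 L))),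
      Filter.Tendsto Ls Filter.atTop Filter.atTop →
      (∀ j, IsGroundStateInSector (hubbardTorusTT' (Ls j) 1 s 8) (rectN 1 (Ls j)) 0 (ψ (Ls j))) →
      (∀ j, star (ψ (Ls j)) ⬝ᵥ ψ (Ls j) = 1) → ω.IsTorusLimitOf ψ Ls →
      (-1 / 5 - s) / (-1 / 5 - -3 / 10) * vI₂a + (s - -3 / 10) / (-1 / 5 - -3 / 10) * vI₂b ≤
        ((Finset.univ : Finset (DihedralGroup 4)).card : ℝ)⁻¹ * ∑ g ∈ (Finset.univ : Finset (DihedralGroup 4)),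
          (ω.expect (d4ShiftSet g 0 (Literature.Probability.LatticeModels.box 2 7))
            (fermionEmbed (PolySite.d4Emb g 0 (Literature.Probability.LatticeModels.box 2 7)) (-oddMomentObsTT s 8 0))).re)
    (hO₂ : ∀ s ∈ Set.Icc (-(21 / 55) : ℝ) (-3 / 10),
      ∀ (ω : InfVolFermionState 2) (Ls : ℕ → ℕ) (ψ : ∀ L, Fock (Orb (FermionTorus 2 L))),
      Filter.Tendsto Ls Filter.atTop Filter.atTop →
      (∀ j, IsGroundStateInSector (hubbardTorusTT' (Ls j) 1 s 8) (rectN 1 (Ls j)) 0 (ψ (Ls j))) →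
      (∀ j, star (ψ (Ls j)) ⬝ᵥ ψ (Ls j) = 1) → ω.IsTorusLimitOf ψ Ls →
      (-3 / 10 - s) / (-3 / 10 - -(21 / 55)) * vO₂a + (s - -(21 / 55)) / (-3 / 10 - -(21 / 55)) * vO₂b ≤
        ((Finset.univ : Finset (DihedralGroup 4)).card : ℝ)⁻¹ * ∑ g ∈ (Finset.univ : Finset (DihedralGroup 4)),
          (ω.expect (d4ShiftSet g 0 (Literature.Probability.LatticeModels.box 2 7))
            (fermionEmbed (PolySite.d4Emb g 0 (Literature.Probability.LatticeModels.box 2 7)) (-oddMomentObsTT (-3 / 10) 8 0))).re)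
    (hI₃ : ∀ s ∈ Set.Icc (-3 / 10 : ℝ) (-1 / 5),
      ∀ (ω : InfVolFermionState 2) (Ls : ℕ → ℕ) (ψ : ∀ L, Fock (Orb (FermionTorus 2 L))),
      Filter.Tendsto Ls Filter.atTop Filter.atTop →
      (∀ j, IsGroundStateInSector (hubbardTorusTT' (Ls j) 1 s 11) (rectN 1 (Ls j)) 0 (ψ (Ls j))) →
      (∀ j, star (ψ (Ls j)) ⬝ᵥ ψ (Ls j) = 1) → ω.IsTorusLimitOf ψ Ls →
      (-1 / 5 - s) / (-1 / 5 - -3 / 10) * vI₃a + (s - -3 / 10) / (-1 / 5 - -3 / 10) * vI₃b ≤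
        ((Finset.univ : Finset (DihedralGroup 4)).card : ℝ)⁻¹ * ∑ g ∈ (Finset.univ : Finset (DihedralGroup 4)),
          (ω.expect (d4ShiftSet g 0 (Literature.Probability.LatticeModels.box 2 7))
            (fermionEmbed (PolySite.d4Emb g 0 (Literature.Probability.LatticeModels.box 2 7)) (-oddMomentObsTT s 11 0))).re)
    (hO₃ : ∀ s ∈ Set.Icc (-(279 / 740) : ℝ) (-3 / 10),
      ∀ (ω : InfVolFermionState 2) (Ls : ℕ → ℕ) (ψ : ∀ L, Fock (Orb (FermionTorus 2 L))),
      Filter.Tendsto Ls Filter.atTop Filter.atTop →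
      (∀ j, IsGroundStateInSector (hubbardTorusTT' (Ls j) 1 s 11) (rectN 1 (Ls j)) 0 (ψ (Ls j))) →
      (∀ j, star (ψ (Ls j)) ⬝ᵥ ψ (Ls j) = 1) → ω.IsTorusLimitOf ψ Ls →
      (-3 / 10 - s) / (-3 / 10 - -(279 / 740)) * vO₃a + (s - -(279 / 740)) / (-3 / 10 - -(279 / 740)) * vO₃b ≤
        ((Finset.univ : Finset (DihedralGroup 4)).card : ℝ)⁻¹ * ∑ g ∈ (Finset.univ : Finset (DihedralGroup 4)),
          (ω.expect (d4ShiftSet g 0 (Literature.Probability.LatticeModels.box 2 7))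
            (fermionEmbed (PolySite.d4Emb g 0 (Literature.Probability.LatticeModels.box 2 7)) (-oddMomentObsTT (-3 / 10) 11 0))).re) :
    HoldsOn (fun p : OneBandCoord → ℝ => ObsStiffnessSeqCeilingAt (p .tpOverT) (p .UOverT) (p .filling) c) boxLa214E_M2b :=
  boxLa214E_M2b_stiffnessWord_of_laBoxE_leaf
    (ObsStiffnessSeqCeilingAt_on_laBoxE_of_threeStations_sixChords vI₁a vI₁b vO₁a vO₁b vI₂a vI₂b vO₂a vO₂b vI₃a vI₃b vO₃a vO₃b c
      hcI₁a hcI₁b hcO₁a hcO₁b hcI₂a hcI₂b hcO₂a hcO₂b hcI₃a hcI₃b hcO₃a hcO₃b hI₁ hO₁ hI₂ hO₂ hI₃ hO₃)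

/-- **RUNG LEAF from the SIX BUNDLES of the three-station fallback** (`c ≥` the twelve negated vertex constants, `c ≤ 0.4364687`) ⇒ `La214M2b_StiffnessBoxCeiling`.
[cite: KomaTasaki1994, §1] [cite: ScalapinoWhiteZhang1993, §II] -/
theorem La214M2b_StiffnessBoxCeiling_of_threeStations_sixBundles
    (vI₁a vI₁b vO₁a vO₁b vI₂a vI₂b vO₂a vO₂b vI₃a vI₃b vO₃a vO₃b : ℝ) (c : ℚ) (hbar : c ≤ 4364687 / 10000000)
    (hcI₁a : -vI₁a ≤ ((c : ℚ) : ℝ)) (hcI₁b : -vI₁b ≤ ((c : ℚ) : ℝ)) (hcO₁a : -vO₁a ≤ ((c : ℚ) : ℝ)) (hcO₁b : -vO₁b ≤ ((c : ℚ) : ℝ))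
    (hcI₂a : -vI₂a ≤ ((c : ℚ) : ℝ)) (hcI₂b : -vI₂b ≤ ((c : ℚ) : ℝ)) (hcO₂a : -vO₂a ≤ ((c : ℚ) : ℝ)) (hcO₂b : -vO₂b ≤ ((c : ℚ) : ℝ))
    (hcI₃a : -vI₃a ≤ ((c : ℚ) : ℝ)) (hcI₃b : -vI₃b ≤ ((c : ℚ) : ℝ)) (hcO₃a : -vO₃a ≤ ((c : ℚ) : ℝ)) (hcO₃b : -vO₃b ≤ ((c : ℚ) : ℝ))
    (hI₁ : ∀ s ∈ Set.Icc (-3 / 10 : ℝ) (-1 / 5),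
      ∀ (ω : InfVolFermionState 2) (Ls : ℕ → ℕ) (ψ : ∀ L, Fock (Orb (FermionTorus 2 L))),
      Filter.Tendsto Ls Filter.atTop Filter.atTop →
      (∀ j, IsGroundStateInSector (hubbardTorusTT' (Ls j) 1 s (29 / 5)) (rectN 1 (Ls j)) 0 (ψ (Ls j))) →
      (∀ j, star (ψ (Ls j)) ⬝ᵥ ψ (Ls j) = 1) → ω.IsTorusLimitOf ψ Ls →
      (-1 / 5 - s) / (-1 / 5 - -3 / 10) * vI₁a + (s - -3 / 10) / (-1 / 5 - -3 / 10) * vI₁b ≤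
        ((Finset.univ : Finset (DihedralGroup 4)).card : ℝ)⁻¹ * ∑ g ∈ (Finset.univ : Finset (DihedralGroup 4)),
          (ω.expect (d4ShiftSet g 0 (Literature.Probability.LatticeModels.box 2 7))
            (fermionEmbed (PolySite.d4Emb g 0 (Literature.Probability.LatticeModels.box 2 7)) (-oddMomentObsTT s (29 / 5) 0))).re)
    (hO₁ : ∀ s ∈ Set.Icc (-(153 / 400) : ℝ) (-3 / 10),
      ∀ (ω : InfVolFermionState 2) (Ls : ℕ → ℕ) (ψ : ∀ L, Fock (Orb (FermionTorus 2 L))),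
      Filter.Tendsto Ls Filter.atTop Filter.atTop →
      (∀ j, IsGroundStateInSector (hubbardTorusTT' (Ls j) 1 s (29 / 5)) (rectN 1 (Ls j)) 0 (ψ (Ls j))) →
      (∀ j, star (ψ (Ls j)) ⬝ᵥ ψ (Ls j) = 1) → ω.IsTorusLimitOf ψ Ls →
      (-3 / 10 - s) / (-3 / 10 - -(153 / 400)) * vO₁a + (s - -(153 / 400)) / (-3 / 10 - -(153 / 400)) * vO₁b ≤
        ((Finset.univ : Finset (DihedralGroup 4)).card : ℝ)⁻¹ * ∑ g ∈ (Finset.univ : Finset (DihedralGroup 4)),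
          (ω.expect (d4ShiftSet g 0 (Literature.Probability.LatticeModels.box 2 7))
            (fermionEmbed (PolySite.d4Emb g 0 (Literature.Probability.LatticeModels.box 2 7)) (-oddMomentObsTT (-3 / 10) (29 / 5) 0))).re)
    (hI₂ : ∀ s ∈ Set.Icc (-3 / 10 : ℝ) (-1 / 5),
      ∀ (ω : InfVolFermionState 2) (Ls : ℕ → ℕ) (ψ : ∀ L, Fock (Orb (FermionTorus 2 L))),
      Filter.Tendsto Ls Filter.atTop Filter.atTop →
      (∀ j, IsGroundStateInSector (hubbardTorusTT' (Ls j) 1 s 8) (rectN 1 (Ls j)) 0 (ψ (Ls j))) →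
      (∀ j, star (ψ (Ls j)) ⬝ᵥ ψ (Ls j) = 1) → ω.IsTorusLimitOf ψ Ls →
      (-1 / 5 - s) / (-1 / 5 - -3 / 10) * vI₂a + (s - -3 / 10) / (-1 / 5 - -3 / 10) * vI₂b ≤
        ((Finset.univ : Finset (DihedralGroup 4)).card : ℝ)⁻¹ * ∑ g ∈ (Finset.univ : Finset (DihedralGroup 4)),
          (ω.expect (d4ShiftSet g 0 (Literature.Probability.LatticeModels.box 2 7))
            (fermionEmbed (PolySite.d4Emb g 0 (Literature.Probability.LatticeModels.box 2 7)) (-oddMomentObsTT s 8 0))).re)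
    (hO₂ : ∀ s ∈ Set.Icc (-(21 / 55) : ℝ) (-3 / 10),
      ∀ (ω : InfVolFermionState 2) (Ls : ℕ → ℕ) (ψ : ∀ L, Fock (Orb (FermionTorus 2 L))),
      Filter.Tendsto Ls Filter.atTop Filter.atTop →
      (∀ j, IsGroundStateInSector (hubbardTorusTT' (Ls j) 1 s 8) (rectN 1 (Ls j)) 0 (ψ (Ls j))) →
      (∀ j, star (ψ (Ls j)) ⬝ᵥ ψ (Ls j) = 1) → ω.IsTorusLimitOf ψ Ls →
      (-3 / 10 - s) / (-3 / 10 - -(21 / 55)) * vO₂a + (s - -(21 / 55)) / (-3 / 10 - -(21 / 55)) * vO₂b ≤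
        ((Finset.univ : Finset (DihedralGroup 4)).card : ℝ)⁻¹ * ∑ g ∈ (Finset.univ : Finset (DihedralGroup 4)),
          (ω.expect (d4ShiftSet g 0 (Literature.Probability.LatticeModels.box 2 7))
            (fermionEmbed (PolySite.d4Emb g 0 (Literature.Probability.LatticeModels.box 2 7)) (-oddMomentObsTT (-3 / 10) 8 0))).re)
    (hI₃ : ∀ s ∈ Set.Icc (-3 / 10 : ℝ) (-1 / 5),
      ∀ (ω : InfVolFermionState 2) (Ls : ℕ → ℕ) (ψ : ∀ L, Fock (Orb (FermionTorus 2 L))),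
      Filter.Tendsto Ls Filter.atTop Filter.atTop →
      (∀ j, IsGroundStateInSector (hubbardTorusTT' (Ls j) 1 s 11) (rectN 1 (Ls j)) 0 (ψ (Ls j))) →
      (∀ j, star (ψ (Ls j)) ⬝ᵥ ψ (Ls j) = 1) → ω.IsTorusLimitOf ψ Ls →
      (-1 / 5 - s) / (-1 / 5 - -3 / 10) * vI₃a + (s - -3 / 10) / (-1 / 5 - -3 / 10) * vI₃b ≤
        ((Finset.univ : Finset (DihedralGroup 4)).card : ℝ)⁻¹ * ∑ g ∈ (Finset.univ : Finset (DihedralGroup 4)),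
          (ω.expect (d4ShiftSet g 0 (Literature.Probability.LatticeModels.box 2 7))
            (fermionEmbed (PolySite.d4Emb g 0 (Literature.Probability.LatticeModels.box 2 7)) (-oddMomentObsTT s 11 0))).re)
    (hO₃ : ∀ s ∈ Set.Icc (-(279 / 740) : ℝ) (-3 / 10),
      ∀ (ω : InfVolFermionState 2) (Ls : ℕ → ℕ) (ψ : ∀ L, Fock (Orb (FermionTorus 2 L))),
      Filter.Tendsto Ls Filter.atTop Filter.atTop →
      (∀ j, IsGroundStateInSector (hubbardTorusTT' (Ls j) 1 s 11) (rectN 1 (Ls j)) 0 (ψ (Ls j))) →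
      (∀ j, star (ψ (Ls j)) ⬝ᵥ ψ (Ls j) = 1) → ω.IsTorusLimitOf ψ Ls →
      (-3 / 10 - s) / (-3 / 10 - -(279 / 740)) * vO₃a + (s - -(279 / 740)) / (-3 / 10 - -(279 / 740)) * vO₃b ≤
        ((Finset.univ : Finset (DihedralGroup 4)).card : ℝ)⁻¹ * ∑ g ∈ (Finset.univ : Finset (DihedralGroup 4)),
          (ω.expect (d4ShiftSet g 0 (Literature.Probability.LatticeModels.box 2 7))
            (fermionEmbed (PolySite.d4Emb g 0 (Literature.Probability.LatticeModels.box 2 7)) (-oddMomentObsTT (-3 / 10) 11 0))).re) :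
    La214M2b_StiffnessBoxCeiling :=
  La214M2b_StiffnessBoxCeiling_of_holdsOn hbar
    (boxLa214E_M2b_stiffnessWord_of_threeStations_sixChords vI₁a vI₁b vO₁a vO₁b vI₂a vI₂b vO₂a vO₂b vI₃a vI₃b vO₃a vO₃b c
      hcI₁a hcI₁b hcO₁a hcO₁b hcI₂a hcI₂b hcO₂a hcO₂b hcI₃a hcI₃b hcO₃a hcO₃b hI₁ hO₁ hI₂ hO₂ hI₃ hO₃)

end Summit.Ventures.CertifiedManyBodySolver.Downfold

end
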